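/-
Copyright (c) 2026. All rights reserved.
Released under Apache 2.0 license as described in the file LICENSE.
Authors: abc-iut cell, campaign-S prover seat abc-iut-S6 (wave 2).
-/
import Literature.IUT.LogVolume.TensorPacketLogProofs
import Literature.IUT.LogVolume.FundamentalIdentity
import Literature.NumberTheory.NumberFields.DifferentTameRamification
import HarnessLib

/-!
# [IUTchIV] Proposition 1.2 (iv): the absolutely unramified case — PROOF

Mochizuki, *Inter-universal Teichmüller theory IV*, RIMS manuscript (Apr. 2020), §1, Prop. 1.2 (iv),
kurims p. 11: "If `p > 2` and `e_i = 1` for all `i ∈ I`, then `φ((R_I)^∼) ⊆ (R_I)^∼`", with the printed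
proof "Assertion (iv) follows from assertion (ii), together with the fact that if `p > 2` and `e_i = 1`
for all `i ∈ I`, then we have `d_I = 0`, `a_I = −b_I ∈ ℤ`."  PROOF-ONLY companion of abc-iut-S1's
`TensorPacketRing.lean` (`Prop12iv`), as an implication from the typed `Prop11 p k` (abc-iut-S5).

The one classical input beyond `TensorPacketLogProofs.lean` is **`e = 1 ⇒ 𝔇 = (1)`** (an absolutely
unramified `p`-adic field has trivial different, so `d = 0`): `different_eq_top_of_absRamificationIdx_eq_one`,
obtained from the tree's form of Serre, *Corps locaux* III §6 Prop. 13 (tame case,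
`Literature.NumberTheory.NumberFields.not_pow_dvd_differentIdeal_of_natCast_ramificationIdx_notMem`:
`e ∉ 𝔭 ⇒ 𝔪^e ∤ 𝔇`) with `e = 1`, `𝔭 = pℤ_p`, using abc-iut-S1's `map_maximalIdeal_padicInt`
(`pℤ_p·𝒪 = 𝔪^e`) and the finiteness of the residue fields.  Then `d_I = 0`, `a_I = |I| = −b_I`
(`a_i = 1/e_i = 1 = −b_i`), the element `p ∈ k_i` realises `p^{−b_i}`, and (ii) "In particular" gives
`φ((R_I)^∼) ⊆ p^{−|I|}·(⊗_i p)·(R_I)^∼ = (R_I)^∼`.  No definitions, no named facts, no `sorry`.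
-/

noncomputable section

open Metric Set IsLocalRing
open scoped Pointwise TensorProduct NormedField

namespace Literature.IUT.LogVolume

variable (p : ℕ) [Fact p.Prime]

/-! ## `e = 1 ⇒ 𝔇 = (1)` -/

section OneField

variable (K : Type*) [NontriviallyNormedField K] [instK : NormedAlgebra ℚ_[p] K] [IsUltrametricDist K]
  [ProperSpace K]

include instK in
/-- `𝒪_K` has fraction field `K`. [claim: Mochizuki2012, status: disputed] -/
theorem isFractionRing_integer : IsFractionRing (Valued.integer K) K := by
  haveI := finiteDimensional p K
  exact IsIntegralClosure.isFractionRing_of_finite_extension ℤ_[p] ℚ_[p] K (Valued.integer K)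

/-- The residue field extension `𝔽_p = ℤ_p/pℤ_p → 𝒪_K/𝔪_K` is separable (finite fields are perfect);
the algebra structure is the one induced by `𝔪_K` lying over `𝔪_{ℤ_p}` (abc-iut-S1's
`liesOver_maximalIdeal`, supplied as `haveI`). [claim: Mochizuki2012, status: disputed] -/
theorem isSeparable_residueFields [(maximalIdeal (Valued.integer K)).LiesOver (maximalIdeal ℤ_[p])] :
    Algebra.IsSeparable (ℤ_[p] ⧸ maximalIdeal ℤ_[p])
      (Valued.integer K ⧸ maximalIdeal (Valued.integer K)) := by
  letI : Field (ℤ_[p] ⧸ maximalIdeal ℤ_[p]) := Ideal.Quotient.field _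
  letI : Field (Valued.integer K ⧸ maximalIdeal (Valued.integer K)) := Ideal.Quotient.field _
  haveI : Finite (ℤ_[p] ⧸ maximalIdeal ℤ_[p]) :=
    Finite.of_equiv (ZMod p) (PadicInt.residueField (p := p)).symm.toEquiv
  haveI : PerfectField (ℤ_[p] ⧸ maximalIdeal ℤ_[p]) := PerfectField.ofFinite
  haveI : Algebra.IsAlgebraic (ℤ_[p] ⧸ maximalIdeal ℤ_[p])
      (Valued.integer K ⧸ maximalIdeal (Valued.integer K)) :=
    Algebra.IsAlgebraic.of_finite _ _
  exact Algebra.IsAlgebraic.isSeparable_of_perfectField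

/-- **`e = 1 ⇒ 𝔇 = (1)`**: an absolutely unramified `K` has trivial different ("`d_i = 0`" in the proof
of [IUTchIV] Prop. 1.2 (iv), p. 11; Serre III §6 Prop. 13 with `e = 1` prime to `p`).
[claim: Mochizuki2012, status: disputed] -/
theorem different_eq_top_of_absRamificationIdx_eq_one (he : absRamificationIdx p K = 1) :
    different p K = ⊤ := by
  haveI := finiteDimensional p K
  haveI := isFractionRing_integer p K
  haveI := liesOver_maximalIdeal p K
  haveI := isSeparable_residueFields p K
  set β := maximalIdeal (Valued.integer K) with hβ
  have hp : maximalIdeal ℤ_[p] ≠ ⊥ := by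
    rw [PadicInt.maximalIdeal_eq_span_p, Ne, Ideal.span_singleton_eq_bot]
    exact_mod_cast (Fact.out : p.Prime).ne_zero
  have hfac : (maximalIdeal ℤ_[p]).map (algebraMap ℤ_[p] (Valued.integer K)) = β ^ 1 * ⊤ := by
    rw [Ideal.mul_top, map_maximalIdeal_padicInt p K, he]
  haveI : (β ^ 1).LiesOver (maximalIdeal ℤ_[p]) := by rw [pow_one]; infer_instance
  have hnd : ¬ β ^ 1 ∣ differentIdeal ℤ_[p] (Valued.integer K) :=
    Literature.NumberTheory.NumberFields.not_pow_dvd_differentIdeal_of_natCast_ramificationIdx_notMem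
      ℤ_[p] ℚ_[p] K (Valued.integer K) hp β hfac (by rw [sup_top_eq]) (by
        rw [Nat.cast_one]
        exact fun h ↦ (Ideal.ne_top_iff_one _).mp (Ideal.IsMaximal.ne_top inferInstance) h)
  by_contra h
  apply hnd
  rw [pow_one, Ideal.dvd_iff_le]
  exact le_maximalIdeal h

/-- Hence **`e = 1 ⇒ d = 0`**. [claim: Mochizuki2012, status: disputed] -/
theorem differentOrd_eq_zero_of_absRamificationIdx_eq_one (he : absRamificationIdx p K = 1) :
    differentOrd p K = 0 := by
  have h : different p K = Ideal.span {(1 : Valued.integer K)} := by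
    rw [Ideal.span_singleton_one]
    exact different_eq_top_of_absRamificationIdx_eq_one p K he
  rw [differentOrd_eq_of_span p K h, OneMemClass.coe_one, norm_one, Real.logb_one, neg_zero]

end OneField

/-! ## [IUTchIV] Proposition 1.2 (iv) -/

variable {I : Type} [Fintype I] [DecidableEq I]
variable (k : I → Type) [∀ i, NontriviallyNormedField (k i)] [∀ i, NormedAlgebra ℚ_[p] (k i)]
  [∀ i, IsUltrametricDist (k i)] [∀ i, ProperSpace (k i)]

omit [DecidableEq I] [∀ i, IsUltrametricDist (k i)] [∀ i, ProperSpace (k i)] in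
/-- `⊗_i p = p^{|I|}` in `V`. [claim: Mochizuki2012, status: disputed] -/
theorem purePacket_natCast_prime :
    purePacket p k (fun j ↦ (p : k j)) = ppow p k (Fintype.card I) := by
  have e : (fun j ↦ (p : k j)) = fun j ↦ (p : ℚ_[p]) • (1 : Π i, k i) j := by
    funext j
    rw [Pi.one_apply, Algebra.smul_def, mul_one, map_natCast]
  rw [e, purePacket_smul, purePacket_one, Finset.prod_const, Finset.card_univ, ppow, zpow_natCast,
    Algebra.algebraMap_eq_smul_one]

/-- **[IUTchIV] Prop. 1.2 (iv) from Prop. 1.1** (p. 11): if `p > 2` and `e_i = 1` for all `i`, then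
`φ((R_I)^∼) ⊆ (R_I)^∼` — from (ii) "In particular" with `d_I = 0`, `a_I = −b_I = |I| ∈ ℤ` and
`p ∈ k_i` realising `p^{−b_i}`: the bounding packet `p^{−⌈d_I+a_I⌉}·(⊗_i p)·(R_I)^∼` is `(R_I)^∼`.
[claim: Mochizuki2012, status: disputed] -/
theorem prop12iv_of_prop11 (h11 : Prop11 p k) : Prop12iv p k := by
  intro hI hp he φ hφ
  have h1p : ∀ j, 1 ≤ absRamificationIdx p (k j) := fun j ↦ absRamificationIdx_pos p (k j)
  have hb : ∀ j, logRadiusB p (absRamificationIdx p (k j)) = -1 := fun j ↦ by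
    rw [logRadiusB_eq hp (h1p j) (by rw [he j]; omega), he j, Nat.cast_one, div_one]
  have ha : ∀ j, logRadiusA p (absRamificationIdx p (k j)) = 1 := fun j ↦ by
    rw [logRadiusA_eq hp (h1p j) (by rw [he j]; omega), he j, Nat.cast_one, div_one]
  have hd : ∀ j, differentOrd p (k j) = 0 := fun j ↦
    differentOrd_eq_zero_of_absRamificationIdx_eq_one p (k j) (he j)
  have hh : RealizesNegB p k (fun j ↦ (p : k j)) := fun j ↦ by
    rw [hb j, norm_prime, Real.rpow_neg_one]
  obtain ⟨h1, h2⟩ := prop12ii'_of_prop11 p k h11 hI φ hφ _ hh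
  refine (h1.trans h2).trans (subset_of_eq ?_)
  have hN : ⌈dSum p k + aSum p k⌉ = (Fintype.card I : ℤ) := by
    simp only [dSum, aSum, hd, ha, Finset.sum_const_zero, zero_add, Finset.sum_const,
      Finset.card_univ, nsmul_eq_mul, mul_one]
    exact Int.ceil_natCast _
  rw [hN, purePacket_natCast_prime, ppow_neg_mul_self, one_smul]

end Literature.IUT.LogVolume

end
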